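import Summits.QuantumFields.BalabanUV.Beta.GAN24.StaircaseCurrentPeriodicDeep
import Summits.QuantumFields.BalabanUV.Beta.GAN24.StepCovarianceCellPairingTent
import Summits.QuantumFields.BalabanUV.Beta.GAN24.DeepProfileContourSum

/-!
# `BalabanUV.Beta.GAN24.FaceWordEEValueDeep` — binder row G-an2-4 ∕ (CONV-C), W-slot (α-0), ROW (C)sym AT LEVELS `≥ 1`, typer's PART VI row **T6-VAL**
# (the VALUES of the E-frame forcing's crossed face reads), the (γ) hand's letter **K7-a** (memo `HOME/b2b-balaban-gan24-formalise-leaf-06/g55/HX-VALUES-g55.md` §5–§7):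
# **THE E-SECTOR EXCHANGE FACE WORD OF THE LEVEL-`(j+1)` FORCING AT THE DEEP PERIOD `Lc·N`, VALUED — IT IS THE CELL WORD's PAIRING ONE PERIOD DEEPER MINUS
# `Lc^{2(d+1)}` TIMES THE SAME PAIRING ONE LEVEL UP**:
# `Σ_{x∈box(Lc·N)} Σ_a FF^{(Lc·N)}_L(a,x)·(X̃♮_{j+1} FF^{(Lc·N)}_R)(a,x) = −¼·sf²·wVH_{j+1}⁻¹·( ⟨q^{(Lc·N)}_{μα}, E2_{j+1} q^{(Lc·N)}_{νβ}⟩_{box(Lc·N)} − Lc^{2(d+1)}·⟨q^{(N)}_{μα}, E2_{j+2} q^{(N)}_{νβ}⟩_{box N} )`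
# (`μ ≠ α`, `ν ≠ β`; every `j`, in-block root, every `d`, `Lc ≥ 1`, every `N ≥ 1`), `FF^{(M)}_R(b,z) = Σ'_w [w_β % M = M−1]·Σ'_t [t_ν % M = M−1]·V_j ν t (z,w)_{bβ}`,
# `FF^{(M)}_L(a,x) = Σ'_y [y_α % M = M−1]·Σ'_t [t_μ % M = M−1]·V_j μ t (y,x)_{αa}` the period-`M` two-face currents of the value third jet `V_j = e3OfK Lc G_j (SrecAt … j)`
# (G-an2-4 CRUX TEAM (2), seat `b2b-balaban-gan24-formalise-leaf-06` = the (γ) hand, gen 56; journal [GAN24LEAF06-G56-INTENT1])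

NOT IN PRINT; OUR BOOKKEEPING ([folklore] bookkeeping BY NAME over this lineage's K1b `ExitFaceSlotStaircaseDeep.faceface_e3OfK_eq_stairN ∕ _fst` (the face-gated slot sums are
value-Hessian images of the period-`M` staircase), K2 `StaircaseCurrentPeriodicDeep.stairFace_eq_periodicM ∕ _fstM ∕ qProfile_translateM ∕ abs_qProfile_leM` (bounded periodic
pre-images `q^{(M)}`), K5 `StepCovarianceCellPairingTent.sum_box_E2T_mul_dressedStep_E2_apply_bridge` (the E2–X̃–E2 channel on the deep cell, tent kept) and K3
`DeepProfileContourSum.contourSum_deepProfile` (`𝒬 q^{(Lc·N)} = Lc^{d+1}·q^{(N)}`); 0 `def`, 0 cited fact, 0 `def … : Prop`, 0 sorry).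
HONEST FRAMING (cell contract, verbatim): «discharging `BetaPertH` makes Bałaban's UV stability UNCONDITIONAL — a real constructive-QFT result; it is NOT the continuum
limit and NOT the Clay problem.»  HONEST DEPENDENCY (verbatim): «continuum YM on T⁴ ⇐ BetaPertH ∧ nine spine estimates (0/9 proved); BetaPertH ⇐ (D1) ∧ (D4) ∧ CAP+tail;
G-an2-4 gates asym, D1 and NE2/3/4.»

WHY.  leaf-03 g71's unrolled crossed ledger (VAL-l) carries the forcing's FACE reads at the periods `P_m = Lc^{m+1}`; leaf-02 g69's Parts 45∕47 push road-P2's face read of the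
dressed one-step source onto the fine tables at the deep period `N = Lc·P_m`, leaving exchange face words `Σ_{rr∈box N} Σ'_t χ_N(rr_μ)χ_N(t_ν)·FF^N[(S μ rr ∘ X̃♮) ∘ S ν t]`
of the fine stencil family `S = S^E + S^VH`.  This file VALUES the `E ⊗ E` word in its cell-pairing form (the cell restriction on the pairing site — leaf-06 K4a's swap): exactly as
at the cell period (gen 53's `ExchangeESectorValue`, where the block contour sums of the profiles vanish and the tent drops), but now the profiles have period `Lc·N`, their
block contour sums are `Lc^{d+1}·q^{(N)}` (K3), and K5's tent survives as THE SAME PAIRING ONE LEVEL UP — the depth-tower shape `Xf (k+1) m = c·(V(k+1, m+2) − ρ·V(k+2, m+1))`,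
`ρ = Lc^{2(d+1)}`, that this lineage's `CrossedLedgerTelescope` takes as hypothesis `hface`.  ENGINE (weight 0; leaf-04's SDF-1 + this seat's read-outs, kit j222572 ∕ j222604,
D = 2, Lc = 3, journal [GAN24LEAF06-G56-E1]): at level 1, period index 0, the ratio face word ∕ cell word `= (V(1,2) − 3⁴·V(2,1)) ∕ V(1,1)`, predicted 0.96066256402197, measured
0.96066256402199; and every non-EE sector face word (E⊗VH, VH⊗E, VH⊗VH, multiplier, MIX, RESP) vanishes pattern by pattern at the deep period.

WHAT ([folklore]; generic `d`, in-block root `toSite r`, `Lc ≥ 1` via `NeZero`, `N ≥ 1` via `NeZero`, every `j`, E's pins inside `SrecAt`, any `cΛ`, units `sf sm`):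
* §1 `tsum_sum_mul_const_mul` (a scalar through the `X̃♮`-row series), `deepProfile_eq` (K2's period-`(Lc·N)` profile in K3's spelling), `contourSum_qProfile_deep` (K3 for it);
* §2 **`cellPairing_deep_value`** — the display above for the RAW table `V_j`;
* §3 **`cellPairing_deep_value_units`** (the unit lemma is gen 52's `ExchangeE2E2ChannelTools.unitS_smul_inl_inl` BY NAME — v1.1: the statement-level twin `unitS_smul_inl_inl'` of v1 is no longer declared, `dedup.landed`) — the same for road-P2's unit-scaled sector table `unitS sf sm (cE • V_j)` (factor `((sf·sm)⁻¹sf⁻²cE)²`).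
Asserts NO value of Bałaban's tables beyond this identity; discharges NOTHING of `hX` ∕ `hXu` ∕ (C)_{≥1} ∕ `hB0` ∕ `hBF` ∕ (Q-L) ∕ (hW, hWall); the VH ∕ multiplier ∕ W
sector words of the face read and the junction with Part 45's literal are NOT treated here; NEVER «G-an2-4 closed» as (CONV-C); NOT D1, NOT `BetaPertH`, NOT continuum, NOT Clay.
2026-08-24; no existing file touched.
-/

noncomputable section

open Finset
open scoped BigOperators
open Literature.MathematicalPhysics.QuantumFieldTheory
open Literature.MathematicalPhysics.QuantumFieldTheory.Balaban1983to89
open Literature.MathematicalPhysics.QuantumFieldTheory.Balaban1983to89.Beta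
open ExpKernelCalculus (Site MKer)
open AffineAveraging (box toSite contourSum)
open OneStepResolventKernel (Fib)
open OneStepKernelFamily (KInvStep)
open BalabanStepJetsSucc (E2 wVH)
open Summit.QuantumFields.BalabanUV.Beta.AxialDressingRooted (coDressKBmAt one_le_of_neZero)
open Summit.QuantumFields.BalabanUV.Beta.HessKerDressedUnits (unitK unitS unitS_apply legScale_inl)
open Summit.QuantumFields.BalabanUV.Beta.SpineRooted (e3OfK)
open Summit.QuantumFields.BalabanUV.Beta.WardLocusRecursive (SrecAt)
open Summit.QuantumFields.BalabanUV.Beta.GAN24.ExitFaceSlotStaircaseDeep (faceface_e3OfK_eq_stairN faceface_e3OfK_eq_stairN_fst)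
open Summit.QuantumFields.BalabanUV.Beta.GAN24.StaircaseCurrentPeriodicDeep (stairFace_eq_periodicM stairFace_eq_periodic_fstM qProfile_translateM abs_qProfile_leM)
open Summit.QuantumFields.BalabanUV.Beta.GAN24.StepCovarianceCellPairingTent (sum_box_E2T_mul_dressedStep_E2_apply_bridge)
open Summit.QuantumFields.BalabanUV.Beta.GAN24.DeepProfileContourSum (contourSum_deepProfile)

namespace Summit.QuantumFields.BalabanUV.Beta.GAN24.FaceWordEEValueDeep

variable {d : ℕ} {Lc : ℕ} [NeZero Lc] {r : Fin (d + 1) → ℕ}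

/-! ## §1 Small bookkeeping: a scalar through the row series; K2's deep profile in K3's spelling -/

/-- [folklore] A scalar passes through the `Σ'_z Σ_b X(z,b)·(c·B(z,b))` row series. -/
theorem tsum_sum_mul_const_mul (X B : Site (d + 1) → Fin (d + 1) → ℝ) (c : ℝ) :
    (∑' z : Site (d + 1), ∑ b : Fin (d + 1), X z b * (c * B z b)) = c * ∑' z : Site (d + 1), ∑ b : Fin (d + 1), X z b * B z b := by
  rw [← tsum_mul_left]
  refine tsum_congr fun z => ?_
  rw [Finset.mul_sum]
  exact Finset.sum_congr rfl fun b _ => by ring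

omit [NeZero Lc] in
/-- [folklore] K2's profile `q^{(M)}_{νβ}` at the period `M = Lc·N` (a natural-number product) is K3's profile (spelled with the real ∕ integer products `Lc·N`). -/
theorem deepProfile_eq (N : ℕ) (ν β : Fin (d + 1)) :
    (fun (b' : Fin (d + 1)) (s : Site (d + 1)) =>
      (if b' = ν then ((((Lc * N : ℕ) : ℝ))⁻¹ * (((Lc * N : ℕ) : ℝ))⁻¹) * ((((s β % ((Lc * N : ℕ) : ℤ) : ℤ) : ℝ) - ((((Lc * N : ℕ) : ℝ)) - 1) / 2)) else 0)
        + (if b' = β then (-(((Lc * N : ℕ) : ℝ))⁻¹ * ((((s ν % ((Lc * N : ℕ) : ℤ) : ℤ) : ℝ) - ((((Lc * N : ℕ) : ℝ)) - 1) / 2))) *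
            (if s β % ((Lc * N : ℕ) : ℤ) = ((Lc * N : ℕ) : ℤ) - 1 then (1 : ℝ) else 0) else 0)) =
      (fun (b' : Fin (d + 1)) (s : Site (d + 1)) =>
        (if b' = ν then (((Lc : ℝ) * (N : ℝ))⁻¹ * ((Lc : ℝ) * (N : ℝ))⁻¹) *
            ((((s β % ((Lc : ℤ) * (N : ℤ)) : ℤ) : ℝ) - (((Lc : ℝ) * (N : ℝ)) - 1) / 2)) else 0)
          + (if b' = β then (-((Lc : ℝ) * (N : ℝ))⁻¹ * ((((s ν % ((Lc : ℤ) * (N : ℤ)) : ℤ) : ℝ) - (((Lc : ℝ) * (N : ℝ)) - 1) / 2))) *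
            (if s β % ((Lc : ℤ) * (N : ℤ)) = (Lc : ℤ) * (N : ℤ) - 1 then (1 : ℝ) else 0) else 0)) := by
  funext b' s
  simp only [Nat.cast_mul]

/-- [folklore] **K3 FOR K2's SPELLING**: the `Lc`-block contour sums of the period-`(Lc·N)` profile are `Lc^{d+1}` times the period-`N` profile (`ν ≠ β`, `N ≥ 1`). -/
theorem contourSum_qProfile_deep {N : ℕ} (hN : 1 ≤ N) {ν β : Fin (d + 1)} (hνβ : ν ≠ β) (κ : Fin (d + 1)) (y : Site (d + 1)) :
    contourSum Lc (fun (b' : Fin (d + 1)) (s : Site (d + 1)) =>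
      (if b' = ν then ((((Lc * N : ℕ) : ℝ))⁻¹ * (((Lc * N : ℕ) : ℝ))⁻¹) * ((((s β % ((Lc * N : ℕ) : ℤ) : ℤ) : ℝ) - ((((Lc * N : ℕ) : ℝ)) - 1) / 2)) else 0)
        + (if b' = β then (-(((Lc * N : ℕ) : ℝ))⁻¹ * ((((s ν % ((Lc * N : ℕ) : ℤ) : ℤ) : ℝ) - ((((Lc * N : ℕ) : ℝ)) - 1) / 2))) *
            (if s β % ((Lc * N : ℕ) : ℤ) = ((Lc * N : ℕ) : ℤ) - 1 then (1 : ℝ) else 0) else 0)) κ y =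
      (Lc : ℝ) ^ (d + 1) *
        ((if κ = ν then (((N : ℝ))⁻¹ * ((N : ℝ))⁻¹) * ((((y β % (N : ℤ)) : ℤ) : ℝ) - ((N : ℝ) - 1) / 2) else 0)
          + (if κ = β then (-((N : ℝ))⁻¹ * ((((y ν % (N : ℤ)) : ℤ) : ℝ) - ((N : ℝ) - 1) / 2)) *
            (if y β % (N : ℤ) = (N : ℤ) - 1 then (1 : ℝ) else 0) else 0)) := by
  rw [deepProfile_eq (Lc := Lc) N ν β]
  exact contourSum_deepProfile (Lc := Lc) hN hνβ κ y

/-! ## §2 The E-sector exchange face word at the deep period, valued (raw table) -/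

/-- NOT IN PRINT; OUR BOOKKEEPING.  **THE E⊗E FACE WORD OF THE LEVEL-`(j+1)` FORCING AT PERIOD `Lc·N`, IN CELL-PAIRING FORM, VALUED** (`μ ≠ α`, `ν ≠ β`; every `j`,
in-block root, every `d`, `Lc, N ≥ 1`): with `V_j = e3OfK Lc G_j (SrecAt … j)` (E's pins), `X̃♮ = unitK sf sm G_{j+1}`, `M = Lc·N` and the period-`M` two-face currents
`FF_L(a,x) = Σ'_y χ_M(y_α)·Σ'_t χ_M(t_μ)·V_j μ t (y,x)_{αa}`, `FF_R(b,z) = Σ'_w χ_M(w_β)·Σ'_t χ_M(t_ν)·V_j ν t (z,w)_{bβ}`,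
`Σ_{x∈box M} Σ_a FF_L(a,x)·Σ'_z Σ_b X̃♮(x,z)_{ab}·FF_R(b,z) = (−½)·½·sf²·( wVH_{j+1}⁻¹·⟨q^{(M)}_{μα}, E2_{j+1} q^{(M)}_{νβ}⟩_{box M} − wVH_{j+1}⁻¹·Lc^{2(d+1)}·⟨q^{(N)}_{μα}, E2_{j+2} q^{(N)}_{νβ}⟩_{box N} )`. -/
theorem cellPairing_deep_value (hr : r ∈ box (d + 1) Lc) (sf sm cΛ : ℝ) (j N : ℕ) [NeZero N] {μ α ν β : Fin (d + 1)} (hμα : μ ≠ α) (hνβ : ν ≠ β) :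
    ∑ x ∈ box (d + 1) (Lc * N), ∑ a : Fin (d + 1),
        (∑' y : Site (d + 1), (if y α % ((Lc * N : ℕ) : ℤ) = ((Lc * N : ℕ) : ℤ) - 1 then (1 : ℝ) else 0) *
          ∑' t : Site (d + 1), (if t μ % ((Lc * N : ℕ) : ℤ) = ((Lc * N : ℕ) : ℤ) - 1 then
            e3OfK Lc (coDressKBmAt (toSite r) Lc (KInvStep (d := d) Lc j))
              (SrecAt d Lc (toSite r) ((Lc : ℝ) ^ (d + 1)) (-((Lc : ℝ) ^ (d + 1) * (1 / 2) * (Lc : ℝ) ^ (d + 1))) cΛ j) μ t y (toSite x) (Sum.inl α) (Sum.inl a)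
            else 0)) *
        (∑' z : Site (d + 1), ∑ b : Fin (d + 1), unitK sf sm (coDressKBmAt (toSite r) Lc (KInvStep (d := d) Lc (j + 1))) (toSite x) z (Sum.inl a) (Sum.inl b) *
          (∑' w : Site (d + 1), (if w β % ((Lc * N : ℕ) : ℤ) = ((Lc * N : ℕ) : ℤ) - 1 then (1 : ℝ) else 0) *
            ∑' t : Site (d + 1), (if t ν % ((Lc * N : ℕ) : ℤ) = ((Lc * N : ℕ) : ℤ) - 1 then
              e3OfK Lc (coDressKBmAt (toSite r) Lc (KInvStep (d := d) Lc j))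
                (SrecAt d Lc (toSite r) ((Lc : ℝ) ^ (d + 1)) (-((Lc : ℝ) ^ (d + 1) * (1 / 2) * (Lc : ℝ) ^ (d + 1))) cΛ j) ν t z w (Sum.inl b) (Sum.inl β)
              else 0))) =
      (-(1 / 2 : ℝ)) * (1 / 2 : ℝ) * ((sf * sf) *
        ((wVH d Lc (j + 1))⁻¹ *
            ∑ x ∈ box (d + 1) (Lc * N), ∑ b : Fin (d + 1),
              ((if b = μ then ((((Lc * N : ℕ) : ℝ))⁻¹ * (((Lc * N : ℕ) : ℝ))⁻¹) * ((((toSite x α % ((Lc * N : ℕ) : ℤ) : ℤ) : ℝ) - ((((Lc * N : ℕ) : ℝ)) - 1) / 2)) else 0)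
                + (if b = α then (-(((Lc * N : ℕ) : ℝ))⁻¹ * ((((toSite x μ % ((Lc * N : ℕ) : ℤ) : ℤ) : ℝ) - ((((Lc * N : ℕ) : ℝ)) - 1) / 2))) *
                    (if toSite x α % ((Lc * N : ℕ) : ℤ) = ((Lc * N : ℕ) : ℤ) - 1 then (1 : ℝ) else 0) else 0)) *
              ∑' s : Site (d + 1), ∑ b' : Fin (d + 1), E2 d Lc (j + 1) (toSite x) s (Sum.inl b) (Sum.inl b') *
                ((if b' = ν then ((((Lc * N : ℕ) : ℝ))⁻¹ * (((Lc * N : ℕ) : ℝ))⁻¹) * ((((s β % ((Lc * N : ℕ) : ℤ) : ℤ) : ℝ) - ((((Lc * N : ℕ) : ℝ)) - 1) / 2)) else 0)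
                  + (if b' = β then (-(((Lc * N : ℕ) : ℝ))⁻¹ * ((((s ν % ((Lc * N : ℕ) : ℤ) : ℤ) : ℝ) - ((((Lc * N : ℕ) : ℝ)) - 1) / 2))) *
                      (if s β % ((Lc * N : ℕ) : ℤ) = ((Lc * N : ℕ) : ℤ) - 1 then (1 : ℝ) else 0) else 0)) -
          (wVH d Lc (j + 1))⁻¹ * (((Lc : ℝ) ^ (d + 1) * (Lc : ℝ) ^ (d + 1)) *
            ∑ y ∈ box (d + 1) N, ∑ a : Fin (d + 1),
              ((if a = μ then (((N : ℝ))⁻¹ * ((N : ℝ))⁻¹) * ((((toSite y α % (N : ℤ)) : ℤ) : ℝ) - ((N : ℝ) - 1) / 2) else 0)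
                + (if a = α then (-((N : ℝ))⁻¹ * ((((toSite y μ % (N : ℤ)) : ℤ) : ℝ) - ((N : ℝ) - 1) / 2)) *
                    (if toSite y α % (N : ℤ) = (N : ℤ) - 1 then (1 : ℝ) else 0) else 0)) *
              ∑' s : Site (d + 1), ∑ b' : Fin (d + 1), E2 d Lc (j + 2) (toSite y) s (Sum.inl a) (Sum.inl b') *
                ((if b' = ν then (((N : ℝ))⁻¹ * ((N : ℝ))⁻¹) * ((((s β % (N : ℤ)) : ℤ) : ℝ) - ((N : ℝ) - 1) / 2) else 0)
                  + (if b' = β then (-((N : ℝ))⁻¹ * ((((s ν % (N : ℤ)) : ℤ) : ℝ) - ((N : ℝ) - 1) / 2)) *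
                      (if s β % (N : ℤ) = (N : ℤ) - 1 then (1 : ℝ) else 0) else 0))))) := by
  have hLc : 1 ≤ Lc := one_le_of_neZero Lc
  have hN : 1 ≤ N := one_le_of_neZero N
  have hM : 1 ≤ Lc * N := Nat.mul_pos hLc hN
  -- K5's bridge on the two period-`(Lc·N)` pre-images, with K3's proportional block contour sums
  have hval := sum_box_E2T_mul_dressedStep_E2_apply_bridge hr sf sm j N ((Lc : ℝ) ^ (d + 1))
    (qL := fun b (y : Site (d + 1)) =>
      (if b = μ then ((((Lc * N : ℕ) : ℝ))⁻¹ * (((Lc * N : ℕ) : ℝ))⁻¹) * ((((y α % ((Lc * N : ℕ) : ℤ) : ℤ) : ℝ) - ((((Lc * N : ℕ) : ℝ)) - 1) / 2)) else 0)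
        + (if b = α then (-(((Lc * N : ℕ) : ℝ))⁻¹ * ((((y μ % ((Lc * N : ℕ) : ℤ) : ℤ) : ℝ) - ((((Lc * N : ℕ) : ℝ)) - 1) / 2))) *
            (if y α % ((Lc * N : ℕ) : ℤ) = ((Lc * N : ℕ) : ℤ) - 1 then (1 : ℝ) else 0) else 0))
    (qR := fun b' (s : Site (d + 1)) =>
      (if b' = ν then ((((Lc * N : ℕ) : ℝ))⁻¹ * (((Lc * N : ℕ) : ℝ))⁻¹) * ((((s β % ((Lc * N : ℕ) : ℤ) : ℤ) : ℝ) - ((((Lc * N : ℕ) : ℝ)) - 1) / 2)) else 0)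
        + (if b' = β then (-(((Lc * N : ℕ) : ℝ))⁻¹ * ((((s ν % ((Lc * N : ℕ) : ℤ) : ℤ) : ℝ) - ((((Lc * N : ℕ) : ℝ)) - 1) / 2))) *
            (if s β % ((Lc * N : ℕ) : ℤ) = ((Lc * N : ℕ) : ℤ) - 1 then (1 : ℝ) else 0) else 0))
    (QL := fun a (y : Site (d + 1)) =>
      (if a = μ then (((N : ℝ))⁻¹ * ((N : ℝ))⁻¹) * ((((y α % (N : ℤ)) : ℤ) : ℝ) - ((N : ℝ) - 1) / 2) else 0)
        + (if a = α then (-((N : ℝ))⁻¹ * ((((y μ % (N : ℤ)) : ℤ) : ℝ) - ((N : ℝ) - 1) / 2)) *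
            (if y α % (N : ℤ) = (N : ℤ) - 1 then (1 : ℝ) else 0) else 0))
    (QR := fun b' (s : Site (d + 1)) =>
      (if b' = ν then (((N : ℝ))⁻¹ * ((N : ℝ))⁻¹) * ((((s β % (N : ℤ)) : ℤ) : ℝ) - ((N : ℝ) - 1) / 2) else 0)
        + (if b' = β then (-((N : ℝ))⁻¹ * ((((s ν % (N : ℤ)) : ℤ) : ℝ) - ((N : ℝ) - 1) / 2)) *
            (if s β % (N : ℤ) = (N : ℤ) - 1 then (1 : ℝ) else 0) else 0))
    (fun b y t => qProfile_translateM (d := d) (M := Lc * N) μ α b y t) (fun b' s t => qProfile_translateM (d := d) (M := Lc * N) ν β b' s t)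
    (fun b y => abs_qProfile_leM (d := d) hM μ α b y) (fun b' s => abs_qProfile_leM (d := d) hM ν β b' s)
    (fun κ y => contourSum_qProfile_deep (Lc := Lc) hN hμα κ y) (fun κ y => contourSum_qProfile_deep (Lc := Lc) hN hνβ κ y)
  rw [← hval, Finset.mul_sum]
  refine Finset.sum_congr rfl fun x _ => ?_
  rw [Finset.mul_sum]
  refine Finset.sum_congr rfl fun a _ => ?_
  -- left current: K1b (first-leg form) then K2 (first-leg pre-image)
  rw [faceface_e3OfK_eq_stairN_fst hr cΛ j hM hM μ α (toSite x) a, stairFace_eq_periodic_fstM (Lc := Lc) hM j hμα (toSite x) a]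
  -- right current: pointwise in `(z, b)`, K1b then K2
  have hR : ∀ (z : Site (d + 1)) (b : Fin (d + 1)),
      (∑' w : Site (d + 1), (if w β % ((Lc * N : ℕ) : ℤ) = ((Lc * N : ℕ) : ℤ) - 1 then (1 : ℝ) else 0) *
        ∑' t : Site (d + 1), (if t ν % ((Lc * N : ℕ) : ℤ) = ((Lc * N : ℕ) : ℤ) - 1 then
          e3OfK Lc (coDressKBmAt (toSite r) Lc (KInvStep (d := d) Lc j))
            (SrecAt d Lc (toSite r) ((Lc : ℝ) ^ (d + 1)) (-((Lc : ℝ) ^ (d + 1) * (1 / 2) * (Lc : ℝ) ^ (d + 1))) cΛ j) ν t z w (Sum.inl b) (Sum.inl β)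
          else 0)) =
      (1 / 2 : ℝ) * ∑' s : Site (d + 1), ∑ b' : Fin (d + 1), E2 d Lc (j + 1) z s (Sum.inl b) (Sum.inl b') *
        ((if b' = ν then ((((Lc * N : ℕ) : ℝ))⁻¹ * (((Lc * N : ℕ) : ℝ))⁻¹) * ((((s β % ((Lc * N : ℕ) : ℤ) : ℤ) : ℝ) - ((((Lc * N : ℕ) : ℝ)) - 1) / 2)) else 0)
          + (if b' = β then (-(((Lc * N : ℕ) : ℝ))⁻¹ * ((((s ν % ((Lc * N : ℕ) : ℤ) : ℤ) : ℝ) - ((((Lc * N : ℕ) : ℝ)) - 1) / 2))) *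
            (if s β % ((Lc * N : ℕ) : ℤ) = ((Lc * N : ℕ) : ℤ) - 1 then (1 : ℝ) else 0) else 0)) := by
    intro z b
    rw [faceface_e3OfK_eq_stairN hr cΛ j hM hM ν β z b, stairFace_eq_periodicM (Lc := Lc) hM j hνβ z b]
  simp_rw [hR]
  rw [tsum_sum_mul_const_mul]
  ring

/-! ## §3 The same for the unit-scaled sector table `unitS sf sm (cE • V_j)` -/

/-- [folklore] The scalar passes through a face-gated slot sum and its leg weight: `Σ'_w W w·Σ'_t (if P t then unitS sf sm (c • V) κ t z w (inl b)(inl β) else 0)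
= ((sf·sm)⁻¹sf⁻²c)·Σ'_w W w·Σ'_t (if P t then V κ t z w (inl b)(inl β) else 0)`. -/
theorem faceface_unitS_smul' (sf sm c : ℝ) (V : Fin (d + 1) → (Fin (d + 1) → ℤ) → MKer (d + 1) (Fib d)) (κ : Fin (d + 1)) (P : (Fin (d + 1) → ℤ) → Prop)
    [DecidablePred P] (W : (Fin (d + 1) → ℤ) → ℝ) (zOf wOf : (Fin (d + 1) → ℤ) → (Fin (d + 1) → ℤ)) (b e : Fin (d + 1)) :
    (∑' w : Fin (d + 1) → ℤ, W w * ∑' t : Fin (d + 1) → ℤ, (if P t then unitS sf sm (fun κ u => c • V κ u) κ t (zOf w) (wOf w) (Sum.inl b) (Sum.inl e) else 0)) =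
      ((sf * sm)⁻¹ * (sf⁻¹ * sf⁻¹) * c) *
        ∑' w : Fin (d + 1) → ℤ, W w * ∑' t : Fin (d + 1) → ℤ, (if P t then V κ t (zOf w) (wOf w) (Sum.inl b) (Sum.inl e) else 0) := by
  have hin : ∀ w : Fin (d + 1) → ℤ, (∑' t : Fin (d + 1) → ℤ, (if P t then unitS sf sm (fun κ u => c • V κ u) κ t (zOf w) (wOf w) (Sum.inl b) (Sum.inl e) else 0)) =
      ((sf * sm)⁻¹ * (sf⁻¹ * sf⁻¹) * c) * ∑' t : Fin (d + 1) → ℤ, (if P t then V κ t (zOf w) (wOf w) (Sum.inl b) (Sum.inl e) else 0) := by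
    intro w
    rw [← tsum_mul_left]
    refine tsum_congr fun t => ?_
    split_ifs
    · exact ExchangeE2E2ChannelTools.unitS_smul_inl_inl sf sm c V κ t (zOf w) (wOf w) b e
    · exact (mul_zero _).symm
  simp_rw [hin]
  rw [← tsum_mul_left]
  exact tsum_congr fun w => by ring

/-- NOT IN PRINT; OUR BOOKKEEPING.  **THE SAME VALUE FOR road-P2's UNIT-SCALED E-SECTOR TABLE `S^E = unitS sf sm (cE • V_j)`** (`μ ≠ α`, `ν ≠ β`): the two currents each carry
the factor `K_E = (sf·sm)⁻¹·sf⁻²·cE`, so the cell pairing of §2 with `S^E` in place of `V_j` equals `K_E²` times §2's value. -/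
theorem cellPairing_deep_value_units (hr : r ∈ box (d + 1) Lc) (sf sm cE cΛ : ℝ) (j N : ℕ) [NeZero N] {μ α ν β : Fin (d + 1)} (hμα : μ ≠ α) (hνβ : ν ≠ β) :
    ∑ x ∈ box (d + 1) (Lc * N), ∑ a : Fin (d + 1),
        (∑' y : Site (d + 1), (if y α % ((Lc * N : ℕ) : ℤ) = ((Lc * N : ℕ) : ℤ) - 1 then (1 : ℝ) else 0) *
          ∑' t : Site (d + 1), (if t μ % ((Lc * N : ℕ) : ℤ) = ((Lc * N : ℕ) : ℤ) - 1 then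
            unitS sf sm (fun κ u => cE • e3OfK Lc (coDressKBmAt (toSite r) Lc (KInvStep (d := d) Lc j))
              (SrecAt d Lc (toSite r) ((Lc : ℝ) ^ (d + 1)) (-((Lc : ℝ) ^ (d + 1) * (1 / 2) * (Lc : ℝ) ^ (d + 1))) cΛ j) κ u) μ t y (toSite x) (Sum.inl α) (Sum.inl a)
            else 0)) *
        (∑' z : Site (d + 1), ∑ b : Fin (d + 1), unitK sf sm (coDressKBmAt (toSite r) Lc (KInvStep (d := d) Lc (j + 1))) (toSite x) z (Sum.inl a) (Sum.inl b) *
          (∑' w : Site (d + 1), (if w β % ((Lc * N : ℕ) : ℤ) = ((Lc * N : ℕ) : ℤ) - 1 then (1 : ℝ) else 0) *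
            ∑' t : Site (d + 1), (if t ν % ((Lc * N : ℕ) : ℤ) = ((Lc * N : ℕ) : ℤ) - 1 then
              unitS sf sm (fun κ u => cE • e3OfK Lc (coDressKBmAt (toSite r) Lc (KInvStep (d := d) Lc j))
                (SrecAt d Lc (toSite r) ((Lc : ℝ) ^ (d + 1)) (-((Lc : ℝ) ^ (d + 1) * (1 / 2) * (Lc : ℝ) ^ (d + 1))) cΛ j) κ u) ν t z w (Sum.inl b) (Sum.inl β)
              else 0))) =
      (((sf * sm)⁻¹ * (sf⁻¹ * sf⁻¹) * cE) * ((sf * sm)⁻¹ * (sf⁻¹ * sf⁻¹) * cE)) *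
      ((-(1 / 2 : ℝ)) * (1 / 2 : ℝ) * ((sf * sf) *
        ((wVH d Lc (j + 1))⁻¹ *
            ∑ x ∈ box (d + 1) (Lc * N), ∑ b : Fin (d + 1),
              ((if b = μ then ((((Lc * N : ℕ) : ℝ))⁻¹ * (((Lc * N : ℕ) : ℝ))⁻¹) * ((((toSite x α % ((Lc * N : ℕ) : ℤ) : ℤ) : ℝ) - ((((Lc * N : ℕ) : ℝ)) - 1) / 2)) else 0)
                + (if b = α then (-(((Lc * N : ℕ) : ℝ))⁻¹ * ((((toSite x μ % ((Lc * N : ℕ) : ℤ) : ℤ) : ℝ) - ((((Lc * N : ℕ) : ℝ)) - 1) / 2))) *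
                    (if toSite x α % ((Lc * N : ℕ) : ℤ) = ((Lc * N : ℕ) : ℤ) - 1 then (1 : ℝ) else 0) else 0)) *
              ∑' s : Site (d + 1), ∑ b' : Fin (d + 1), E2 d Lc (j + 1) (toSite x) s (Sum.inl b) (Sum.inl b') *
                ((if b' = ν then ((((Lc * N : ℕ) : ℝ))⁻¹ * (((Lc * N : ℕ) : ℝ))⁻¹) * ((((s β % ((Lc * N : ℕ) : ℤ) : ℤ) : ℝ) - ((((Lc * N : ℕ) : ℝ)) - 1) / 2)) else 0)
                  + (if b' = β then (-(((Lc * N : ℕ) : ℝ))⁻¹ * ((((s ν % ((Lc * N : ℕ) : ℤ) : ℤ) : ℝ) - ((((Lc * N : ℕ) : ℝ)) - 1) / 2))) *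
                      (if s β % ((Lc * N : ℕ) : ℤ) = ((Lc * N : ℕ) : ℤ) - 1 then (1 : ℝ) else 0) else 0)) -
          (wVH d Lc (j + 1))⁻¹ * (((Lc : ℝ) ^ (d + 1) * (Lc : ℝ) ^ (d + 1)) *
            ∑ y ∈ box (d + 1) N, ∑ a : Fin (d + 1),
              ((if a = μ then (((N : ℝ))⁻¹ * ((N : ℝ))⁻¹) * ((((toSite y α % (N : ℤ)) : ℤ) : ℝ) - ((N : ℝ) - 1) / 2) else 0)
                + (if a = α then (-((N : ℝ))⁻¹ * ((((toSite y μ % (N : ℤ)) : ℤ) : ℝ) - ((N : ℝ) - 1) / 2)) *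
                    (if toSite y α % (N : ℤ) = (N : ℤ) - 1 then (1 : ℝ) else 0) else 0)) *
              ∑' s : Site (d + 1), ∑ b' : Fin (d + 1), E2 d Lc (j + 2) (toSite y) s (Sum.inl a) (Sum.inl b') *
                ((if b' = ν then (((N : ℝ))⁻¹ * ((N : ℝ))⁻¹) * ((((s β % (N : ℤ)) : ℤ) : ℝ) - ((N : ℝ) - 1) / 2) else 0)
                  + (if b' = β then (-((N : ℝ))⁻¹ * ((((s ν % (N : ℤ)) : ℤ) : ℝ) - ((N : ℝ) - 1) / 2)) *
                      (if s β % (N : ℤ) = (N : ℤ) - 1 then (1 : ℝ) else 0) else 0)))))) := by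
  rw [← cellPairing_deep_value hr sf sm cΛ j N hμα hνβ, Finset.mul_sum]
  refine Finset.sum_congr rfl fun x _ => ?_
  rw [Finset.mul_sum]
  refine Finset.sum_congr rfl fun a _ => ?_
  -- units out of the left current
  rw [faceface_unitS_smul' sf sm cE _ μ (fun t : Site (d + 1) => t μ % ((Lc * N : ℕ) : ℤ) = ((Lc * N : ℕ) : ℤ) - 1)
      (fun y : Site (d + 1) => (if y α % ((Lc * N : ℕ) : ℤ) = ((Lc * N : ℕ) : ℤ) - 1 then (1 : ℝ) else 0)) (fun y => y) (fun _ => toSite x) α a]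
  -- units out of the right current, pointwise in `(z, b)`
  have hR : ∀ (z : Site (d + 1)) (b : Fin (d + 1)),
      (∑' w : Site (d + 1), (if w β % ((Lc * N : ℕ) : ℤ) = ((Lc * N : ℕ) : ℤ) - 1 then (1 : ℝ) else 0) *
        ∑' t : Site (d + 1), (if t ν % ((Lc * N : ℕ) : ℤ) = ((Lc * N : ℕ) : ℤ) - 1 then
          unitS sf sm (fun κ u => cE • e3OfK Lc (coDressKBmAt (toSite r) Lc (KInvStep (d := d) Lc j))
            (SrecAt d Lc (toSite r) ((Lc : ℝ) ^ (d + 1)) (-((Lc : ℝ) ^ (d + 1) * (1 / 2) * (Lc : ℝ) ^ (d + 1))) cΛ j) κ u) ν t z w (Sum.inl b) (Sum.inl β)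
          else 0)) =
      ((sf * sm)⁻¹ * (sf⁻¹ * sf⁻¹) * cE) *
        (∑' w : Site (d + 1), (if w β % ((Lc * N : ℕ) : ℤ) = ((Lc * N : ℕ) : ℤ) - 1 then (1 : ℝ) else 0) *
          ∑' t : Site (d + 1), (if t ν % ((Lc * N : ℕ) : ℤ) = ((Lc * N : ℕ) : ℤ) - 1 then
            e3OfK Lc (coDressKBmAt (toSite r) Lc (KInvStep (d := d) Lc j))
              (SrecAt d Lc (toSite r) ((Lc : ℝ) ^ (d + 1)) (-((Lc : ℝ) ^ (d + 1) * (1 / 2) * (Lc : ℝ) ^ (d + 1))) cΛ j) ν t z w (Sum.inl b) (Sum.inl β)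
            else 0)) :=
    fun z b => faceface_unitS_smul' sf sm cE _ ν (fun t : Site (d + 1) => t ν % ((Lc * N : ℕ) : ℤ) = ((Lc * N : ℕ) : ℤ) - 1)
      (fun w : Site (d + 1) => (if w β % ((Lc * N : ℕ) : ℤ) = ((Lc * N : ℕ) : ℤ) - 1 then (1 : ℝ) else 0)) (fun _ => z) (fun w => w) b β
  simp_rw [hR]
  rw [tsum_sum_mul_const_mul]
  ring

end Summit.QuantumFields.BalabanUV.Beta.GAN24.FaceWordEEValueDeep

end
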